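import Summits.QuantumFields.YangMills.Theorems.BalabanLadderIRReflectedAntipodalCofinal
import Summits.QuantumFields.YangMills.Theorems.BalabanLadderIRAntipodalCode
import HarnessLib

/-!
# Crux `BalabanLadder.IRcof` (stmt-QuantumFields-26930): the cofinal leaf IS reflected antipodal mirror decay on a cofinal coupling set
# (ideator ym-ir-idea-14 gen 4, LINE E part R-leaf; helper for stmt-QuantumFields-19354 ∕ 26930)

HONEST STATUS.  Reflection-positivity bookkeeping only: `IRcof_iff_reflected : Theses.BalabanLadder.IRcof ↔ IRcofRefl` (the cofinal LEAF
itself re-faced, companion of `IR_iff_reflected` for the uniform leaf 19354) and `anti_iff_irnscRefl` (LINE E's token ANTI ⟺ the reflected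
residual `IRnscRefl` BY NAME).  Nothing here proves `IRcof`, `IR`, `IRnsc`, `IRnscCof`, ANTI, any lattice mass gap or the Clay Yang–Mills
problem (R4 = `BalabanLadder.UV` only; IR 0/1, IRcof 0/1, legs 0/6).
-/

open MeasureTheory Filter Topology
open Literature.MathematicalPhysics.QuantumFieldTheory Literature.MathematicalPhysics.QuantumLattice
open Summit.QuantumFields.YangMills.Cruxes.OSLegsFromFemtoAndGap.DlrCollarTransfer (GapInUnits LowerBounds)
open Summit.QuantumFields.YangMills.Cruxes.IR.ColdPressurePincer (IRnsc)

noncomputable section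

namespace Summit.QuantumFields.YangMills.Cruxes.IR.ReflectedAntipodal

/-- **`IRcofRefl` — the cofinal leaf `BalabanLadder.IRcof` with its conclusion restricted to the reflected mirror pairs at the antipode**:
for compact simple `G`, floors ⇒ a cofinal coupling set carrying reflected antipodal mirror decay of every single species. -/
def IRcofRefl : Prop :=
  ∀ (G : Type) [Group G] [TopologicalSpace G] [IsTopologicalGroup G] [CompactSpace G],
    IsCompactSimpleLieGroup G →
    letI : MeasurableSpace G := borel G
    haveI : BorelSpace G := ⟨rfl⟩
    ∀ (r : LatticeRep G) (a : ℝ → ℝ), (∀ β, 0 < a β) → Tendsto a atTop (𝓝 0) → LowerBounds G r a →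
      ∃ Bset : Set ℝ, (∀ x : ℝ, ∃ β ∈ Bset, x ≤ β) ∧ ReflectedAntipodalDecayOn G r a Bset

/-- **The cofinal leaf `BalabanLadder.IRcof` (stmt-QuantumFields-26930) IS reflected antipodal mirror decay on a cofinal coupling set**
(PROVED equivalence; `gapOn_iff_reflectedAntipodalOn` coupling set by coupling set). -/
theorem IRcof_iff_reflected : Summit.QuantumFields.YangMills.Theses.BalabanLadder.IRcof ↔ IRcofRefl := by
  constructor
  · intro h G _ _ _ _ hG
    letI : MeasurableSpace G := borel G
    haveI : BorelSpace G := ⟨rfl⟩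
    intro r a ha ha0 hlb
    obtain ⟨Bset, hcof, hgap⟩ := h G hG r a ha ha0 hlb
    exact ⟨Bset, hcof, reflectedAntipodalOn_of_gapOn hgap⟩
  · intro h G _ _ _ _ hG
    letI : MeasurableSpace G := borel G
    haveI : BorelSpace G := ⟨rfl⟩
    intro r a ha ha0 hlb
    obtain ⟨Bset, hcof, hre⟩ := h G hG r a ha ha0 hlb
    exact ⟨Bset, hcof, gapOn_of_reflectedAntipodalOn ha ha0 hre⟩

/-- **LINE E's token ANTI ⟺ the reflected residual `IRnscRefl` BY NAME** (PROVED; `AntipodalCode.irnscRefl_of_anti` one way,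
`IRnsc_iff_reflected` + `AntipodalCode.anti_of_irnsc` the other). -/
theorem anti_iff_irnscRefl : Summit.QuantumFields.YangMills.Cruxes.IR.AntipodalCode.AntipodalMirrorDecay ↔ IRnscRefl :=
  ⟨Summit.QuantumFields.YangMills.Cruxes.IR.AntipodalCode.irnscRefl_of_anti,
    fun h => Summit.QuantumFields.YangMills.Cruxes.IR.AntipodalCode.anti_of_irnsc (IRnsc_iff_reflected.2 h)⟩

end Summit.QuantumFields.YangMills.Cruxes.IR.ReflectedAntipodal

end
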